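import Literature.RepresentationTheory.HeisenbergGroup.DoubledDeltaInvariantFunctional
import Literature.RepresentationTheory.HeisenbergGroup.MetaplecticSumStrippingRight
import Literature.RepresentationTheory.HeisenbergGroup.SchrodingerIsotropicEigenfunctional
import Literature.RepresentationTheory.HeisenbergGroup.SchrodingerConjugate
import HarnessLib

/-!
# The local doubling identity in the `ℓ_Δ`-model: the Gaussian functional of a Cayley graph kills the Frobenius
# transform of `f₁ ⊠ conj f₂` whenever `⟨ω(γ⁻¹) f₁, f₂⟩ = 0`

Topic `RepresentationTheory/HeisenbergGroup`; namespace `Literature.RepresentationTheory.HeisenbergGroup`.  A definition with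
body (`boxEquivSB`) and theorems; no named fact, no record, no `sorry`.

Setting: the doubled Gram duality `T = T₀ ⊕ (−T₀)` on `F^ι = F^κ ⊕ F^κ` of `DoubledDeltaPolarisation.lean` /
`DoubledDeltaFrobenius.lean` over a non-archimedean local field `F` (`2` invertible), the Frobenius transform
`T_Δ : 𝒮(F^ι) ≃ 𝒮(F^ι)` onto the `ℓ_Δ`-Schrödinger model (`DoubledDeltaInvariantFunctional.exists_deltaFrobeniusEquiv`), a
symplectic `g ∈ Sp(𝕎₀)` of the first block with an implementer `M₁` on `ρ_{T₀}` and its inverse-free Cayley transform `C`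
(`C (g w − w) = g w + w`, `g − 1` surjective), read on `X_Δ = F^ι` as `b(u) = glue (C (u|₁, u|₂))`.

* §1 `boxEquivSB e M₁ M₂ : 𝒮(F^ι) ≃ₗ[ℂ] 𝒮(F^ι)`, the operator `M₁ ⊠ M₂` (`(M₁ ⊠ M₂)(f₁ ⊠ f₂) = M₁ f₁ ⊠ M₂ f₂`), so that
  `MetaplecticSumStrippingRight.implements_of_boxSB` applies; `Implements ρ 1 1`.
* §2 MAIN **`integral_gauss_mul_deltaFrobenius_boxSB_eq_zero`**: if `∫ conj(M₁⁻¹ f₁) · f₂ = 0`, then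
  `∫_{X_Δ} ψ(½ β_Δ(u, b u)) · T_Δ(f₁ ⊠ conj f₂)(u) du = 0`, GIVEN the two algebraic facts about the Cayley graph
  (hypotheses `hsym`, `hgraph`; tree `DoubledDeltaCayleyGraph.lean`): `β_Δ(x, b x')` is symmetric, and
  `Φ_Δ((g ⊕ 1) · (ℓ_Δ-element)) = ((x, b x), ½ β_Δ(x, b x))` lies on the canonical lift of the graph of `b`.
  PROOF («lifted-Lagrangian functional uniqueness»): the functional `Λ'' = L_b ∘ T_Δ ∘ (M₁ ⊠ 1)` with
  `L_b(φ) = ∫ ψ(½β_Δ(u,bu)) φ` is `ℓ_Δ`-invariant — `M₁ ⊠ 1` implements `g ⊕ 1` (`implements_of_boxSB`), `T_Δ`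
  intertwines `ρ_T` with `ρ_Δ ∘ Φ_Δ` (`equiv_schrodingerSB_of_coe_eq_deltaFrobenius`), and `L_b` is an eigenfunctional of the
  canonical lift of the graph (`integral_gauss_mul_schrodingerSB`) — hence `Λ'' = c · (diagonal integral)`
  (`exists_eq_mul_diagIntegral_of_forall_deltaW`); at `F = M₁⁻¹ f₁ ⊠ conj f₂` the diagonal integral is
  `conj ∫ conj(M₁⁻¹f₁) f₂ = 0` while `(M₁ ⊠ 1) F = f₁ ⊠ conj f₂`.

This is the local form of the basic identity of the doubling method ([PiatetskiShapiroRallis1987, §1–§2]: the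
Siegel–Weil section of `Φ₁ ⊗ Φ̄₂` restricted to `G × 1` is the matrix coefficient `⟨ω(g)Φ₁, Φ₂⟩`), in the generality
needed for [Howe1979, §11]'s density argument (cell `hodgecm-mathlib`, KEY `b4-howe-compact-irreducible`, node (I) of
`MoeglinVignerasWaldspurger1987.mvw_IV4_rankOne_irreducibleOrZero`).  Nothing else is asserted.

## References
* [PiatetskiShapiroRallis1987] S. Gelbart, I. Piatetski-Shapiro, S. Rallis, *Explicit Constructions of Automorphic
  L-Functions*, LNM 1254 (1987), Part A §1–§2.
* [Howe1979] R. Howe, *θ-series and invariant theory*, Proc. Symp. Pure Math. 33.1 (1979), §11.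
* [MoeglinVignerasWaldspurger1987] C. Mœglin, M.-F. Vignéras, J.-L. Waldspurger, LNM 1291 (1987), Chap. 2 II.1, Chap. 3 IV.4.
-/

set_option autoImplicit false

noncomputable section

open _root_.MeasureTheory
open scoped ComplexConjugate TensorProduct Matrix
open Literature.NumberTheory.Automorphic

namespace Literature.RepresentationTheory.HeisenbergGroup

/-! ## §1 The operator `M₁ ⊠ M₂` -/

section Box

variable (K : Type*) [Field K] [ValuativeRel K] [TopologicalSpace K] [IsNonarchimedeanLocalField K]
  {ι₁ ι₂ ι : Type*} [Fintype ι₁] [Fintype ι₂] [Fintype ι] [DecidableEq ι₁] [DecidableEq ι₂] [DecidableEq ι]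
  (e : ι₁ ⊕ ι₂ ≃ ι)

/-- **`M₁ ⊠ M₂`** as a linear automorphism of `𝒮(K^ι) = 𝒮(K^{ι₁}) ⊗ 𝒮(K^{ι₂})` (through `sumEquivSB`).
[cite: MoeglinVignerasWaldspurger1987, Chap. 2 II.1 Rem. (6)] -/
def boxEquivSB (M₁ : SchwartzBruhat (ι₁ → K) ≃ₗ[ℂ] SchwartzBruhat (ι₁ → K))
    (M₂ : SchwartzBruhat (ι₂ → K) ≃ₗ[ℂ] SchwartzBruhat (ι₂ → K)) :
    SchwartzBruhat (ι → K) ≃ₗ[ℂ] SchwartzBruhat (ι → K) :=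
  (sumEquivSB K e).symm ≪≫ₗ TensorProduct.congr M₁ M₂ ≪≫ₗ sumEquivSB K e

omit [DecidableEq ι₁] [DecidableEq ι₂] [DecidableEq ι] in
/-- `(M₁ ⊠ M₂)(f₁ ⊠ f₂) = M₁ f₁ ⊠ M₂ f₂`. [cite: MoeglinVignerasWaldspurger1987, Chap. 2 II.1 Rem. (6)] -/
theorem boxEquivSB_boxSB (M₁ : SchwartzBruhat (ι₁ → K) ≃ₗ[ℂ] SchwartzBruhat (ι₁ → K))
    (M₂ : SchwartzBruhat (ι₂ → K) ≃ₗ[ℂ] SchwartzBruhat (ι₂ → K)) (f₁ : SchwartzBruhat (ι₁ → K))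
    (f₂ : SchwartzBruhat (ι₂ → K)) :
    boxEquivSB K e M₁ M₂ (boxSB K e f₁ f₂) = boxSB K e (M₁ f₁) (M₂ f₂) := by
  rw [boxEquivSB, LinearEquiv.trans_apply, LinearEquiv.trans_apply, sumEquivSB_symm_boxSB, TensorProduct.congr_tmul,
    sumEquivSB_tmul]

end Box

/-- the identity implements the identity. [cite: MoeglinVignerasWaldspurger1987, Chap. 2 II.1 (A)] -/
theorem implements_one_refl {R : Type*} [CommRing R] {V : Type*} [AddCommGroup V] [Module R V] {B : V →ₗ[R] V →ₗ[R] R}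
    {k : Type*} [CommRing k] {S : Type*} [AddCommGroup S] [Module k S] (ρ : Representation k (Heisenberg B) S) :
    Implements ρ (1 : Heisenberg.PseudoSymplectic B) (LinearEquiv.refl k S) := fun h f => by
  rw [Heisenberg.PseudoSymplectic.act_one]; rfl

/-! ## §2 The doubling identity -/

section Doubling

variable {F : Type*} [Field F] [ValuativeRel F] [TopologicalSpace F] [IsNonarchimedeanLocalField F]
  {κ ι : Type*} [Fintype κ] [Fintype ι] [DecidableEq κ] [DecidableEq ι]
  (e : κ ⊕ κ ≃ ι) (T₀ : Matrix κ κ F) {T : Matrix ι ι F}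
  (hT : T = Matrix.reindex e e (Matrix.fromBlocks T₀ 0 0 (-T₀)))
  {ψ : AddChar F Circle} (hl : IsLocallyConstant (⇑ψ : F → Circle))
  (hb₀ : ∀ y : κ → F, Continuous fun u : κ → F => Matrix.toLinearMap₂' F T₀ u y)
  (hb₀' : ∀ y : κ → F, Continuous fun u : κ → F => Matrix.toLinearMap₂' F (-T₀) u y)
  (hb : ∀ y : ι → F, Continuous fun u : ι → F => Matrix.toLinearMap₂' F T u y)
  (hbΔ : ∀ y : ι → F, Continuous fun u : ι → F => Matrix.toLinearMap₂' F (deltaGram e T₀) u y)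
  [MeasurableSpace (κ → F)] [BorelSpace (κ → F)] (μ : Measure (κ → F)) [μ.IsAddHaarMeasure]
  [MeasurableSpace (ι → F)] [BorelSpace (ι → F)] (ν : Measure (ι → F)) [ν.IsAddHaarMeasure]
  [Invertible (2 : F)]

include hT hb₀' hbΔ in
/-- **the local doubling identity** (see the file header). [cite: Howe1979, §11] -/
theorem integral_gauss_mul_deltaFrobenius_boxSB_eq_zero (hψ : ψ.IsContinuousNontrivial) (hT₀ : IsUnit T₀.det)
    (g : symplecticGroup (polar (Matrix.toLinearMap₂' F T₀)))
    (M₁ : SchwartzBruhat (κ → F) ≃ₗ[ℂ] SchwartzBruhat (κ → F))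
    (hM₁ : Implements (schrodingerSB (Matrix.toLinearMap₂' F T₀) ψ hl hb₀) (ofSymplectic _ g) M₁)
    (b : (ι → F) →ₗ[F] (ι → F))
    (hsym : ∀ u u' : ι → F,
      Matrix.toLinearMap₂' F (deltaGram e T₀) u (b u') = Matrix.toLinearMap₂' F (deltaGram e T₀) u' (b u))
    (hgraph : ∀ α β : κ → F, ∃ x : ι → F,
      deltaHeisenbergEquiv e T₀ hT ((ofSymplectic _ (spInl e T₀ (-T₀) hT g)).act ⟨deltaW e α β, 0⟩) =
        ⟨(x, b x), ⅟(2 : F) * Matrix.toLinearMap₂' F (deltaGram e T₀) x (b x)⟩)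
    (f₁ f₂ : SchwartzBruhat (κ → F))
    (horth : ∫ u, conj (((M₁.symm f₁ : SchwartzBruhat (κ → F)) : (κ → F) → ℂ) u) *
      ((f₂ : SchwartzBruhat (κ → F)) : (κ → F) → ℂ) u ∂μ = 0)
    (𝒯 : SchwartzBruhat (ι → F) ≃ₗ[ℂ] SchwartzBruhat (ι → F))
    (h𝒯 : ∀ Φ : SchwartzBruhat (ι → F), ((𝒯 Φ : SchwartzBruhat (ι → F)) : (ι → F) → ℂ) =
      frobeniusToSchrodinger ((schrodingerSB (Matrix.toLinearMap₂' F T) ψ hl hb).comp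
        (deltaHeisenbergEquiv e T₀ hT).symm.toMonoidHom : Representation ℂ _ (SchwartzBruhat (ι → F)))
        (diagIntegral e μ) Φ) :
    ∫ u, ((ψ (⅟(2 : F) * Matrix.toLinearMap₂' F (deltaGram e T₀) u (b u)) : Circle) : ℂ) *
      ((𝒯 (boxSB F e f₁ (conjSB f₂)) : SchwartzBruhat (ι → F)) : (ι → F) → ℂ) u ∂ν = 0 := by
  -- the phase `q` and the Gaussian functional `L`
  set q : (ι → F) → F := fun u => ⅟(2 : F) * Matrix.toLinearMap₂' F (deltaGram e T₀) u (b u) with hq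
  have hq_add : ∀ u x : ι → F, q (u + x) = q u + q x + Matrix.toLinearMap₂' F (deltaGram e T₀) u (b x) := by
    intro u x
    simp only [hq, map_add, LinearMap.add_apply, hsym x u]
    have h2 : ⅟(2 : F) * 2 = 1 := invOf_mul_self _
    linear_combination (Matrix.toLinearMap₂' F (deltaGram e T₀) u (b x)) * h2
  have hbcont : Continuous b := by
    have : (⇑b) = fun v => LinearMap.toMatrix' b *ᵥ v := by
      funext v; rw [← Matrix.toLin'_apply, Matrix.toLin'_toMatrix']
    rw [this]; exact continuous_const.matrix_mulVec continuous_id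
  have hqc : Continuous q := by
    simp only [hq, Matrix.toLinearMap₂'_apply']
    exact continuous_const.mul (continuous_id.dotProduct (continuous_const.matrix_mulVec hbcont))
  have hphase : Continuous fun u : ι → F => ((ψ (q u - (0 : (ι → F) →+ F) u) : Circle) : ℂ) :=
    ((hl.comp_continuous (hqc.sub continuous_const)).comp ((↑) : Circle → ℂ)).continuous
  obtain ⟨L, hL⟩ := exists_linearMap_eq_integral_gauss_mul ν (fun u => ((ψ (q u - (0 : (ι → F) →+ F) u) : Circle) : ℂ))
    hphase
  -- the operator `M₁ ⊠ 1` implements `g ⊕ 1`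
  set M := boxEquivSB F e M₁ (LinearEquiv.refl ℂ (SchwartzBruhat (κ → F))) with hMdef
  have hMbox : ∀ (φ₁ φ₂ : SchwartzBruhat (κ → F)), M (boxSB F e φ₁ φ₂) = boxSB F e (M₁ φ₁) (LinearEquiv.refl ℂ _ φ₂) :=
    fun φ₁ φ₂ => boxEquivSB_boxSB F e M₁ _ φ₁ φ₂
  have hM : Implements (schrodingerSB (Matrix.toLinearMap₂' F T) ψ hl hb)
      (ofSymplectic _ (spInl e T₀ (-T₀) hT g * spInr e T₀ (-T₀) hT 1)) M := by
    refine implements_of_boxSB e T₀ (-T₀) hT hl hb₀ hb₀' hb g 1 hM₁ ?_ hMbox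
    rw [map_one]; exact implements_one_refl _
  rw [map_one, mul_one] at hM
  -- the invariant functional `Λ'' = L ∘ 𝒯 ∘ M`
  set Λ'' : SchwartzBruhat (ι → F) →ₗ[ℂ] ℂ := L ∘ₗ (𝒯 : SchwartzBruhat (ι → F) →ₗ[ℂ] SchwartzBruhat (ι → F)) ∘ₗ
    (M : SchwartzBruhat (ι → F) →ₗ[ℂ] SchwartzBruhat (ι → F)) with hΛ''
  have hinv : ∀ (α β : κ → F) (Φ : SchwartzBruhat (ι → F)),
      Λ'' (schrodingerSB (Matrix.toLinearMap₂' F T) ψ hl hb ⟨deltaW e α β, 0⟩ Φ) = Λ'' Φ := by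
    intro α β Φ
    obtain ⟨x, hx⟩ := hgraph α β
    simp only [hΛ'', LinearMap.coe_comp, Function.comp_apply, LinearEquiv.coe_coe]
    rw [hM, equiv_schrodingerSB_of_coe_eq_deltaFrobenius e T₀ hT hl hb μ hbΔ 𝒯 h𝒯, hx, hL, hL]
    have key := integral_gauss_mul_schrodingerSB (Matrix.toLinearMap₂' F (deltaGram e T₀)) ψ ν hl hbΔ q
      (0 : (ι → F) →+ F) (x := x) (y := b x) (fun u => hq_add u x) (𝒯 (M Φ))
    rw [key, AddMonoidHom.zero_apply, AddChar.map_zero_eq_one, Circle.coe_one, one_mul]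
  obtain ⟨c, hc⟩ := exists_eq_mul_diagIntegral_of_forall_deltaW e T₀ hT hl hb μ hψ hT₀ Λ'' hinv
  -- evaluate at `F = M₁⁻¹ f₁ ⊠ conj f₂`
  have hval := hc (boxSB F e (M₁.symm f₁) (conjSB f₂))
  have hdiag : diagIntegral e μ (boxSB F e (M₁.symm f₁) (conjSB f₂)) = 0 := by
    rw [diagIntegral_apply]
    simp only [boxSB_apply_glue, coe_conjSB_apply]
    have : ∫ u, ((M₁.symm f₁ : SchwartzBruhat (κ → F)) : (κ → F) → ℂ) u * conj (((f₂ : SchwartzBruhat (κ → F)) :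
        (κ → F) → ℂ) u) ∂μ = conj (∫ u, conj (((M₁.symm f₁ : SchwartzBruhat (κ → F)) : (κ → F) → ℂ) u) *
          ((f₂ : SchwartzBruhat (κ → F)) : (κ → F) → ℂ) u ∂μ) := by
      rw [← integral_conj]
      refine integral_congr_ae (Filter.Eventually.of_forall fun u => ?_)
      simp only [map_mul, RCLike.conj_conj]
    rw [this, horth, map_zero]
  have hLHS : Λ'' (boxSB F e (M₁.symm f₁) (conjSB f₂)) =
      ∫ u, ((ψ (⅟(2 : F) * Matrix.toLinearMap₂' F (deltaGram e T₀) u (b u)) : Circle) : ℂ) *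
        ((𝒯 (boxSB F e f₁ (conjSB f₂)) : SchwartzBruhat (ι → F)) : (ι → F) → ℂ) u ∂ν := by
    simp only [hΛ'', LinearMap.coe_comp, Function.comp_apply, LinearEquiv.coe_coe, hMbox, LinearEquiv.apply_symm_apply,
      LinearEquiv.refl_apply, hL, AddMonoidHom.zero_apply, sub_zero]
    rfl
  rw [← hLHS, hval, hdiag, mul_zero]

end Doubling

end Literature.RepresentationTheory.HeisenbergGroup

end
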